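import Summits.CriticalPhenomena.PercolationContinuityZ3.Theorems.PercNearOneGluingNoHeavyLowerTailCovTauStarNReal
import HarnessLib

/-!
# KN Question 8 at `|A| = 3`, covariance side (J1): the POCKETED MARKER DECISION-TREE STEP (S5)

Support file (`--supports stmt-CriticalPhenomena-4575`, closed crux; independent mathematics on Kozma–Nitzan's Question 8 at
`|A| = 3`), prover `prim-hp-7` (gen 38).  No named facts, no sorries; standard axioms.
Memo `prim-ineq-gen-6/PROOF-STAR1.md` Step 3 = display (S5) and `FINDING-G14.md` §4 (the route PCOV = J1 + CEN, J1 ⟸ (★₁) ∧ T2 by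
`CovTau.metaA2_abstract`); Lean plan (L2) there.  This file is (L2): the one genuinely new step of the proof of (★₁).

SETTING (finitary, on the coordinates `D : Finset (Sym2 V)` with weights `p ∈ [0,1]^D`, expectations `ED`, as in
`…CovTauStarNReal.lean`).  Owner `x`, observer `o`, marker `v`; a source set `M` (the `N'` of the memo); a set `Z` of vertices the
observer's pocket must avoid (`Z' = {x,v} ∪ Y ∪ N'` in the memo; here only `x ∈ Z` is used); `Ψ` monotone nonnegative on edge sets,
`F = Ψ(C_x)` (`CovTauStarN.fcl`).  Explore the open cluster of the SET `N'' = M ∪ {o}` (prim-ineq-gen-6's `SetClusterExploration`,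
σ-field `𝒢₁`; it reveals exactly the pairs of `D` meeting `C_{N''}`, and outside them the hybrid is the world `G ∖ C_{N''}` =
`off (reached D N'' K)`).
* the WINDOW `𝒲 = {M ↮ x} ∩ {M ↮ v} ∩ {o ↮ Z}` (`PcovJ1.wSet`; `𝒢₁`-measurable; on it `x ∉ C_{N''}`);
* the AVOIDANCE EVENT `A_ev = {x ↮ v} ∩ {M ↮ v} ∩ {o ↮ Z}` (`PcovJ1.aevSet`), whose probability is the functional `⟨α⟩` of the J1 route;
* the POCKETED MARKER BRACKET `⟨h₁⟩ = E[ 1_𝒲 · Cov(F, 1{x ↔ v} | 𝒢₁) ] = ED(1_𝒲(K) · covOff(reached D N'' K))` (`PcovJ1.h1ED`).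

THEOREM (S5) (`PcovJ1.markerDT_ED`):   `⟨h₁⟩ ≤ E F · μ(A_ev) − E[F ; A_ev]`   (`= μ(A_ev)·(E F − E[F | A_ev]) = −Cov(F, 1_{A_ev})`).
PROOF (memo Step 3, formalised verbatim along `CovTauStarN.starN_ED`): Gladkov's decision-tree Harris inequality
(`TreeHarris.treeHarris_real`) for `E[F | 𝒢₁]` and the increasing event `B = A_evᶜ = {x↔v} ∪ {M↔v} ∪ {o↔Z}` gives
`E[ĝ 1_{A_ev}] ≤ E F · μ(A_ev)` (`ĝ = E[F|𝒢₁]`); the bookkeeping `1_{A_ev} = 1_{A₁} + 1_𝒲·1{x↮v}` with `A₁ = {M ↔ x} ∩ {M ↮ v} ∩ {o ↮ Z}`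
and `𝒲` both `𝒢₁`-measurable, the tower property and the Markov property on `𝒲` (`CovTauStarN.splice_congr_of_not_mem_reached`) give
`E[ĝ 1_{A_ev}] − E[F 1_{A_ev}] = E[1_𝒲 F 1{x↔v}] − E[1_𝒲 ĝ ĥ] = ⟨h₁⟩` (`ĥ = E[1{x↔v}|𝒢₁]`).
[cite: Gladkov2024, Thm. 3.2 (p. 4), Lemma 3.1] [cite: VandenbergHaggstromKahn2005, eq. (6) (p. 4)] [cite: KozmaNitzan2024, Question 8 (§5.5 p. 36)]
-/

noncomputable section

namespace Summit.CriticalPhenomena.PercolationContinuityZ3.Theorems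

namespace PcovJ1

open Finset Literature.Probability.Percolation Literature.Probability.Percolation.DecisionTree
open SetClusterExploration TreeHarris CovTauStarN
open scoped Classical

variable {V : Type*} [Fintype V] [DecidableEq V]

/-! ### The window, the avoidance event, the pocketed marker bracket -/

/-- The WINDOW `𝒲 = {M ↮ x} ∩ {M ↮ v} ∩ {o ↮ Z}` (as a set of finite configurations): the worlds of the exploration of
`C_{M ∪ {o}}` on which the pocketed marker covariance lives. [cite: VandenbergHaggstromKahn2005, eq. (6) (p. 4)] -/
def wSet (x o v : V) (M Z : Finset V) : Set (Finset (Sym2 V)) :=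
  {L | (∀ s ∈ M, ¬ (openGraph (↑L : Set (Sym2 V))).Reachable s x) ∧
    (∀ s ∈ M, ¬ (openGraph (↑L : Set (Sym2 V))).Reachable s v) ∧
    (∀ z ∈ Z, ¬ (openGraph (↑L : Set (Sym2 V))).Reachable o z)}

/-- The AVOIDANCE EVENT `A_ev = {x ↮ v} ∩ {M ↮ v} ∩ {o ↮ Z}` (its probability is the functional `⟨α⟩` of the J1 route).
[cite: KozmaNitzan2024, Question 8 (§5.5 p. 36)] -/
def aevSet (x o v : V) (M Z : Finset V) : Set (Finset (Sym2 V)) :=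
  {L | ¬ (openGraph (↑L : Set (Sym2 V))).Reachable x v ∧
    (∀ s ∈ M, ¬ (openGraph (↑L : Set (Sym2 V))).Reachable s v) ∧
    (∀ z ∈ Z, ¬ (openGraph (↑L : Set (Sym2 V))).Reachable o z)}

/-- The decided part `A₁ = {M ↔ x} ∩ {M ↮ v} ∩ {o ↮ Z}` of the avoidance event (there `x ↮ v` is automatic). [folklore] -/
def a1Set (x o v : V) (M Z : Finset V) : Set (Finset (Sym2 V)) :=
  {L | (∃ s ∈ M, (openGraph (↑L : Set (Sym2 V))).Reachable s x) ∧
    (∀ s ∈ M, ¬ (openGraph (↑L : Set (Sym2 V))).Reachable s v) ∧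
    (∀ z ∈ Z, ¬ (openGraph (↑L : Set (Sym2 V))).Reachable o z)}

/-- The increasing event `B = {x ↔ v} ∪ {M ↔ v} ∪ {o ↔ Z}` (the complement of `A_ev`). [folklore] -/
def bSet (x o v : V) (M Z : Finset V) : Set (Finset (Sym2 V)) :=
  {L | (openGraph (↑L : Set (Sym2 V))).Reachable x v ∨
    (∃ s ∈ M, (openGraph (↑L : Set (Sym2 V))).Reachable s v) ∨
    (∃ z ∈ Z, (openGraph (↑L : Set (Sym2 V))).Reachable o z)}

/-- **The pocketed marker bracket** `⟨h₁⟩ = ED( 1_𝒲(K) · Cov_{G ∖ C_{M∪{o}}(K)}(Ψ(C_x), 1{x ↔ v}) )` — the world covariance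
`CovTauStarN.covOff` outside the explored cluster of the set `M ∪ {o}`, integrated over the window.
[cite: VandenbergHaggstromKahn2005, eq. (6) (p. 4)] [cite: KozmaNitzan2024, Question 8 (§5.5 p. 36)] -/
def h1ED (D : Finset (Sym2 V)) (p : Sym2 V → ℝ) (Ψ : Set (Sym2 V) → ℝ) (x o v : V) (M Z : Finset V) : ℝ :=
  ED D p (fun K => ind (wSet x o v M Z) K * covOff D p Ψ x v (reached D (insert o M) K))

/-! ### Pointwise facts -/

omit [Fintype V] [DecidableEq V] in
/-- `1_B = 1 − 1_{A_ev}`. [folklore] -/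
theorem ind_bSet_eq (x o v : V) (M Z : Finset V) (K : Finset (Sym2 V)) :
    ind (bSet x o v M Z) K = 1 - ind (aevSet x o v M Z) K := by
  by_cases h : K ∈ aevSet x o v M Z
  · have hB : K ∉ bSet x o v M Z := by
      obtain ⟨h1, h2, h3⟩ := h
      rintro (h' | ⟨s, hs, h'⟩ | ⟨z, hz, h'⟩)
      exacts [h1 h', h2 s hs h', h3 z hz h']
    rw [ind_of_mem h, ind_of_not_mem hB]; ring
  · have hB : K ∈ bSet x o v M Z := by
      simp only [aevSet, Set.mem_setOf_eq, not_and_or, not_forall, not_not] at h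
      rcases h with h' | ⟨s, hs, h'⟩ | ⟨z, hz, h'⟩
      · exact Or.inl h'
      · exact Or.inr (Or.inl ⟨s, hs, h'⟩)
      · exact Or.inr (Or.inr ⟨z, hz, h'⟩)
    rw [ind_of_not_mem h, ind_of_mem hB]; ring

omit [Fintype V] [DecidableEq V] in
/-- `B` is increasing. [folklore] -/
theorem isUpperSet_bSet (x o v : V) (M Z : Finset V) : IsUpperSet (bSet x o v M Z) := by
  intro L L' hLL' hL
  have hmono : openGraph (↑L : Set (Sym2 V)) ≤ openGraph (↑L' : Set (Sym2 V)) :=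
    openGraph_mono (Finset.coe_subset.2 hLL')
  rcases hL with h | ⟨s, hs, h⟩ | ⟨z, hz, h⟩
  · exact Or.inl (h.mono hmono)
  · exact Or.inr (Or.inl ⟨s, hs, h.mono hmono⟩)
  · exact Or.inr (Or.inr ⟨z, hz, h.mono hmono⟩)

omit [Fintype V] [DecidableEq V] in
/-- **Bookkeeping**: `1_{A_ev} = 1_{A₁} + 1_𝒲 · (1 − 1{x ↔ v})`. [folklore] -/
theorem ind_aevSet_eq (x o v : V) (M Z : Finset V) (K : Finset (Sym2 V)) :
    ind (aevSet x o v M Z) K = ind (a1Set x o v M Z) K + ind (wSet x o v M Z) K * (1 - hr x v K) := by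
  unfold hr
  by_cases hx : ∃ s ∈ M, (openGraph (↑K : Set (Sym2 V))).Reachable s x
  · -- `M ↔ x`: the window is empty, and `A_ev = A₁`
    have hW : K ∉ wSet x o v M Z := fun h => by
      obtain ⟨s, hs, hsx⟩ := hx; exact h.1 s hs hsx
    rw [ind_of_not_mem hW, zero_mul, add_zero]
    by_cases h : K ∈ aevSet x o v M Z
    · obtain ⟨_, h2, h3⟩ := h
      rw [ind_of_mem (show K ∈ aevSet x o v M Z from ⟨‹_›, h2, h3⟩),
        ind_of_mem (show K ∈ a1Set x o v M Z from ⟨hx, h2, h3⟩)]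
    · have h' : K ∉ a1Set x o v M Z := by
        rintro ⟨⟨s, hs, hsx⟩, h2, h3⟩
        exact h ⟨fun hxv => h2 s hs (hsx.trans hxv), h2, h3⟩
      rw [ind_of_not_mem h, ind_of_not_mem h']
  · -- `M ↮ x`: `A₁` is empty, and `A_ev = 𝒲 ∩ {x ↮ v}`
    have hA1 : K ∉ a1Set x o v M Z := fun h => hx h.1
    rw [ind_of_not_mem hA1, zero_add]
    push Not at hx
    by_cases h : K ∈ aevSet x o v M Z
    · obtain ⟨h1, h2, h3⟩ := h
      rw [ind_of_mem (show K ∈ aevSet x o v M Z from ⟨h1, h2, h3⟩),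
        ind_of_mem (show K ∈ wSet x o v M Z from ⟨hx, h2, h3⟩),
        ind_of_not_mem (show K ∉ {L : Finset (Sym2 V) | (openGraph (↑L : Set (Sym2 V))).Reachable x v} from h1)]
      ring
    · rw [ind_of_not_mem h]
      by_cases hW : K ∈ wSet x o v M Z
      · obtain ⟨_, h2, h3⟩ := hW
        have hxv : (openGraph (↑K : Set (Sym2 V))).Reachable x v := by
          by_contra hxv; exact h ⟨hxv, h2, h3⟩
        rw [ind_of_mem (show K ∈ wSet x o v M Z from ⟨‹_›, h2, h3⟩),
          ind_of_mem (show K ∈ {L : Finset (Sym2 V) | (openGraph (↑L : Set (Sym2 V))).Reachable x v} from hxv)]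
        ring
      · rw [ind_of_not_mem hW]; ring

/-- On the window the owner is not swallowed by the explored cluster of `M ∪ {o}` (uses `x ∈ Z`). [folklore] -/
theorem not_mem_reached_of_wSet {D : Finset (Sym2 V)} {x o v : V} {M Z : Finset V} (hxZ : x ∈ Z)
    {K : Finset (Sym2 V)} (hK : K ⊆ D) (hW : K ∈ wSet x o v M Z) : x ∉ reached D (insert o M) K := by
  intro hx
  obtain ⟨s, hs, hsx⟩ := (mem_reached_iff' hK).1 hx
  rcases Finset.mem_insert.1 hs with rfl | hsM
  · exact hW.2.2 x hxZ hsx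
  · exact hW.1 s hsM hsx

/-- The root set is reached. [folklore] -/
theorem mem_reached_of_mem_root {D : Finset (Sym2 V)} {N : Finset V} {K : Finset (Sym2 V)} (hK : K ⊆ D) {s : V}
    (hs : s ∈ N) : s ∈ reached D N K :=
  (mem_reached_iff' hK).2 ⟨s, hs, SimpleGraph.Reachable.refl s⟩

/-- **Locality**: the window is decided by the exploration of `C_{M ∪ {o}}`. [cite: Gladkov2024, Lemma 3.1] -/
theorem wSet_splice_iff {D : Finset (Sym2 V)} (x o v : V) (M Z : Finset V) {K K₂ : Finset (Sym2 V)} (hK : K ⊆ D)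
    (hK₂ : K₂ ⊆ D) :
    splice (revealedAt D (insert o M) K) K K₂ ∈ wSet x o v M Z ↔ K ∈ wSet x o v M Z := by
  have key : ∀ s ∈ insert o M, ∀ z, (openGraph (↑K : Set (Sym2 V))).Reachable s z ↔
      (openGraph (↑(splice (revealedAt D (insert o M) K) K K₂) : Set (Sym2 V))).Reachable s z :=
    fun s hs => (splice_congr_of_mem_reached hK hK₂ (mem_reached_of_mem_root hK hs)).1
  have ho : o ∈ insert o M := Finset.mem_insert_self o M
  have hM : ∀ s ∈ M, s ∈ insert o M := fun s hs => Finset.mem_insert_of_mem hs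
  simp only [wSet, Set.mem_setOf_eq]
  refine and_congr (forall₂_congr fun s hs => not_congr (key s (hM s hs) x).symm)
    (and_congr (forall₂_congr fun s hs => not_congr (key s (hM s hs) v).symm)
      (forall₂_congr fun z _ => not_congr (key o ho z).symm))

/-- **Locality**: `A₁` is decided by the exploration of `C_{M ∪ {o}}`. [cite: Gladkov2024, Lemma 3.1] -/
theorem a1Set_splice_iff {D : Finset (Sym2 V)} (x o v : V) (M Z : Finset V) {K K₂ : Finset (Sym2 V)} (hK : K ⊆ D)
    (hK₂ : K₂ ⊆ D) :
    splice (revealedAt D (insert o M) K) K K₂ ∈ a1Set x o v M Z ↔ K ∈ a1Set x o v M Z := by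
  have key : ∀ s ∈ insert o M, ∀ z, (openGraph (↑K : Set (Sym2 V))).Reachable s z ↔
      (openGraph (↑(splice (revealedAt D (insert o M) K) K K₂) : Set (Sym2 V))).Reachable s z :=
    fun s hs => (splice_congr_of_mem_reached hK hK₂ (mem_reached_of_mem_root hK hs)).1
  have ho : o ∈ insert o M := Finset.mem_insert_self o M
  have hM : ∀ s ∈ M, s ∈ insert o M := fun s hs => Finset.mem_insert_of_mem hs
  simp only [a1Set, Set.mem_setOf_eq]
  refine and_congr (exists_congr fun s => and_congr_right fun hs => (key s (hM s hs) x).symm)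
    (and_congr (forall₂_congr fun s hs => not_congr (key s (hM s hs) v).symm)
      (forall₂_congr fun z _ => not_congr (key o ho z).symm))

/-! ### (S5) -/

/-- **(S5) — the pocketed marker decision-tree step** (prim-ineq-gen-6, PROOF-STAR1.md Step 3): for `x ∈ Z` and `Ψ` monotone
nonnegative on edge sets,  `⟨h₁⟩ ≤ E Ψ(C_x) · μ(A_ev) − E[Ψ(C_x) ; A_ev]`  (`= −Cov(Ψ(C_x), 1_{A_ev})`).
[cite: Gladkov2024, Thm. 3.2 (p. 4), Lemma 3.1] [cite: VandenbergHaggstromKahn2005, eq. (6) (p. 4)] -/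
theorem markerDT_ED (D : Finset (Sym2 V)) {p : Sym2 V → ℝ} (hp0 : ∀ e, 0 ≤ p e) (hp1 : ∀ e, p e ≤ 1)
    (Ψ : Set (Sym2 V) → ℝ) (hΨ : Monotone Ψ) (hΨ0 : ∀ C, 0 ≤ Ψ C) (x o v : V) (M Z : Finset V) (hxZ : x ∈ Z) :
    h1ED D p Ψ x o v M Z ≤
      ED D p (fcl Ψ x) * ED D p (ind (aevSet x o v M Z)) -
        ED D p (fun K => fcl Ψ x K * ind (aevSet x o v M Z) K) := by
  have hSD : SelfDetermined (revealedAt D (insert o M)) := selfDetermined_revealedAt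
  have hrev : revealed (ttree D (D.card + 1) (init (insert o M))) = revealedAt D (insert o M) :=
    funext fun K => (revealedAt_eq_revealed (D := D) (insert o M) K).symm
  /- 1. MARKOV on the window: the conditional expectations given the exploration of `C_{M ∪ {o}}`. -/
  have hA : ∀ K ∈ D.powerset, x ∉ reached D (insert o M) K →
      cE D p (revealedAt D (insert o M)) (fun L => fcl Ψ x L * hr x v L) K =
          ED D p (fun K₂ => fcl Ψ x (off (reached D (insert o M) K) K₂) *
            hr x v (off (reached D (insert o M) K) K₂)) ∧
        cE D p (revealedAt D (insert o M)) (fcl Ψ x) K =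
          ED D p (fun K₂ => fcl Ψ x (off (reached D (insert o M) K) K₂)) ∧
        cE D p (revealedAt D (insert o M)) (hr x v) K =
          ED D p (fun K₂ => hr x v (off (reached D (insert o M) K) K₂)) := by
    intro K hK hx
    rw [Finset.mem_powerset] at hK
    have hpt : ∀ K₂ ∈ D.powerset,
        fcl Ψ x (splice (revealedAt D (insert o M) K) K K₂) = fcl Ψ x (off (reached D (insert o M) K) K₂) ∧
          hr x v (splice (revealedAt D (insert o M) K) K K₂) = hr x v (off (reached D (insert o M) K) K₂) := by
      intro K₂ hK₂
      rw [Finset.mem_powerset] at hK₂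
      obtain ⟨hreach, hclu⟩ := splice_congr_of_not_mem_reached hK hK₂ hx
      exact ⟨by simp only [fcl, hclu], BystanderBHK.ind_congr (hreach v).symm⟩
    refine ⟨?_, ?_, ?_⟩
    · exact Finset.sum_congr rfl fun K₂ hK₂ => by
        show wtW D p K₂ * (fcl Ψ x _ * hr x v _) = _
        rw [(hpt K₂ hK₂).1, (hpt K₂ hK₂).2]
    · exact Finset.sum_congr rfl fun K₂ hK₂ => by rw [(hpt K₂ hK₂).1]
    · exact Finset.sum_congr rfl fun K₂ hK₂ => by rw [(hpt K₂ hK₂).2]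
  /- 2. LOCALITY of the window and of `A₁`. -/
  have hWloc : ∀ K ∈ D.powerset, ∀ K₂ ∈ D.powerset,
      ind (wSet x o v M Z) (splice (revealedAt D (insert o M) K) K K₂) = ind (wSet x o v M Z) K := by
    intro K hK K₂ hK₂
    rw [Finset.mem_powerset] at hK hK₂
    exact BystanderBHK.ind_congr (wSet_splice_iff x o v M Z hK hK₂)
  have hA1loc : ∀ K ∈ D.powerset, ∀ K₂ ∈ D.powerset,
      ind (a1Set x o v M Z) (splice (revealedAt D (insert o M) K) K K₂) = ind (a1Set x o v M Z) K := by
    intro K hK K₂ hK₂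
    rw [Finset.mem_powerset] at hK hK₂
    exact BystanderBHK.ind_congr (a1Set_splice_iff x o v M Z hK hK₂)
  /- 3. ⟨h₁⟩ through conditional expectations: `⟨h₁⟩ = E[1_𝒲 F 1{x↔v}] − E[1_𝒲 ĝ 1{x↔v}]`. -/
  have hH1 : h1ED D p Ψ x o v M Z =
      ED D p (fun K => ind (wSet x o v M Z) K * cE D p (revealedAt D (insert o M)) (fun L => fcl Ψ x L * hr x v L) K) -
        ED D p (fun K => ind (wSet x o v M Z) K *
          (cE D p (revealedAt D (insert o M)) (fcl Ψ x) K * cE D p (revealedAt D (insert o M)) (hr x v) K)) := by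
    unfold h1ED
    rw [← ED_sub]
    refine ED_congr_on D p fun K hK => ?_
    by_cases hW : K ∈ wSet x o v M Z
    · have hx := not_mem_reached_of_wSet hxZ (Finset.mem_powerset.1 hK) hW
      obtain ⟨h1, h2, h3⟩ := hA K hK hx
      rw [h1, h2, h3, covOff]; ring
    · rw [ind_of_not_mem hW]; ring
  have hT1 : ED D p (fun K => ind (wSet x o v M Z) K *
      cE D p (revealedAt D (insert o M)) (fun L => fcl Ψ x L * hr x v L) K) =
      ED D p (fun K => ind (wSet x o v M Z) K * (fcl Ψ x K * hr x v K)) := by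
    calc ED D p (fun K => ind (wSet x o v M Z) K *
          cE D p (revealedAt D (insert o M)) (fun L => fcl Ψ x L * hr x v L) K)
        = ED D p (cE D p (revealedAt D (insert o M)) (fun L => ind (wSet x o v M Z) L * (fcl Ψ x L * hr x v L))) :=
          ED_congr_on D p fun K hK => by
            rw [cE_mul_of_local_on D p (revealedAt D (insert o M)) (fun K₂ hK₂ => hWloc K hK K₂ hK₂)]
      _ = _ := ED_cE D p hSD _
  have hT2 : ED D p (fun K => ind (wSet x o v M Z) K *
      (cE D p (revealedAt D (insert o M)) (fcl Ψ x) K * cE D p (revealedAt D (insert o M)) (hr x v) K)) =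
      ED D p (fun K => ind (wSet x o v M Z) K * (cE D p (revealedAt D (insert o M)) (fcl Ψ x) K * hr x v K)) := by
    calc ED D p (fun K => ind (wSet x o v M Z) K *
          (cE D p (revealedAt D (insert o M)) (fcl Ψ x) K * cE D p (revealedAt D (insert o M)) (hr x v) K))
        = ED D p (fun K => (ind (wSet x o v M Z) K * cE D p (revealedAt D (insert o M)) (fcl Ψ x) K) *
            cE D p (revealedAt D (insert o M)) (hr x v) K) := ED_congr_on D p fun K _ => by ring
      _ = ED D p (fun K => cE D p (revealedAt D (insert o M))
            (fun L => ind (wSet x o v M Z) L * cE D p (revealedAt D (insert o M)) (fcl Ψ x) L) K * hr x v K) :=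
          ED_mul_cE_comm D p hSD _ _
      _ = _ := ED_congr_on D p fun K hK => by
          rw [cE_mul_of_local_on D p (revealedAt D (insert o M)) (fun K₂ hK₂ => hWloc K hK K₂ hK₂),
            cE_cE D p (revealedAt D (insert o M)) hSD (fcl Ψ x) K]
          ring
  /- 4. DECISION-TREE HARRIS for `E[F | 𝒢₁]` and the increasing event `B = A_evᶜ`. -/
  have hTH0 := treeHarris_real D hp0 hp1 (ttree D (D.card + 1) (init (insert o M))) (fcl_mono Ψ x hΨ)
    (fun K => hΨ0 _) (isUpperSet_bSet x o v M Z)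
  rw [hrev, PrW_eq_sum_ind] at hTH0
  have h1c : ED D p (fun _ => (1 : ℝ)) = 1 := by unfold ED; rw [← Finset.sum_mul, sum_wtW, one_mul]
  have hPB : ∑ S ∈ D.powerset, wtW D p S * ind (bSet x o v M Z) S = 1 - ED D p (ind (aevSet x o v M Z)) := by
    rw [← h1c, ← ED_sub]
    exact Finset.sum_congr rfl fun K _ => by rw [ind_bSet_eq]
  have hRB : ED D p (fun K => cE D p (revealedAt D (insert o M)) (fcl Ψ x) K * ind (bSet x o v M Z) K) =
      ED D p (fcl Ψ x) - ED D p (fun K => cE D p (revealedAt D (insert o M)) (fcl Ψ x) K * ind (aevSet x o v M Z) K) := by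
    rw [← ED_cE D p hSD (fcl Ψ x), ← ED_sub]
    exact ED_congr_on D p fun K _ => by rw [ind_bSet_eq]; ring
  rw [hPB, hRB] at hTH0
  -- hTH0 : E F · (1 − α) ≤ E F − E[ĝ 1_{A_ev}], i.e. E[ĝ 1_{A_ev}] ≤ E F · α
  /- 5. `E[ĝ 1_{A_ev}]` and `E[F 1_{A_ev}]` through the bookkeeping identity. -/
  have hGa : ED D p (fun K => cE D p (revealedAt D (insert o M)) (fcl Ψ x) K * ind (aevSet x o v M Z) K) =
      ED D p (fun K => fcl Ψ x K * ind (a1Set x o v M Z) K) +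
        ED D p (fun K => ind (wSet x o v M Z) K * fcl Ψ x K) -
        ED D p (fun K => ind (wSet x o v M Z) K * (cE D p (revealedAt D (insert o M)) (fcl Ψ x) K * hr x v K)) := by
    have e1 : ED D p (fun K => cE D p (revealedAt D (insert o M)) (fcl Ψ x) K * ind (a1Set x o v M Z) K) =
        ED D p (fun K => fcl Ψ x K * ind (a1Set x o v M Z) K) := by
      calc ED D p (fun K => cE D p (revealedAt D (insert o M)) (fcl Ψ x) K * ind (a1Set x o v M Z) K)
          = ED D p (cE D p (revealedAt D (insert o M)) (fun L => ind (a1Set x o v M Z) L * fcl Ψ x L)) :=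
            ED_congr_on D p fun K hK => by
              rw [cE_mul_of_local_on D p (revealedAt D (insert o M)) (fun K₂ hK₂ => hA1loc K hK K₂ hK₂)]; ring
        _ = ED D p (fun L => ind (a1Set x o v M Z) L * fcl Ψ x L) := ED_cE D p hSD _
        _ = _ := ED_congr_on D p fun K _ => by ring
    have e2 : ED D p (fun K => cE D p (revealedAt D (insert o M)) (fcl Ψ x) K * ind (wSet x o v M Z) K) =
        ED D p (fun K => ind (wSet x o v M Z) K * fcl Ψ x K) := by
      calc ED D p (fun K => cE D p (revealedAt D (insert o M)) (fcl Ψ x) K * ind (wSet x o v M Z) K)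
          = ED D p (cE D p (revealedAt D (insert o M)) (fun L => ind (wSet x o v M Z) L * fcl Ψ x L)) :=
            ED_congr_on D p fun K hK => by
              rw [cE_mul_of_local_on D p (revealedAt D (insert o M)) (fun K₂ hK₂ => hWloc K hK K₂ hK₂)]; ring
        _ = _ := ED_cE D p hSD _
    rw [← e1, ← e2, ← ED_add, ← ED_sub]
    exact ED_congr_on D p fun K _ => by rw [ind_aevSet_eq]; ring
  have hFa : ED D p (fun K => fcl Ψ x K * ind (aevSet x o v M Z) K) =
      ED D p (fun K => fcl Ψ x K * ind (a1Set x o v M Z) K) +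
        ED D p (fun K => ind (wSet x o v M Z) K * fcl Ψ x K) -
        ED D p (fun K => ind (wSet x o v M Z) K * (fcl Ψ x K * hr x v K)) := by
    rw [← ED_add, ← ED_sub]
    exact ED_congr_on D p fun K _ => by rw [ind_aevSet_eq]; ring
  /- 6. Assembly. -/
  rw [hH1, hT1, hT2]
  linarith [hGa, hFa, hTH0]

end PcovJ1

end Summit.CriticalPhenomena.PercolationContinuityZ3.Theorems

end
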